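import Summits.ResolutionOfSingularities.ResolutionOfSingularities.Theorems.HilbertSamuelEliminationSigmaMaxModificationsCorridor3WLadderStrataCurve
import Literature.AlgebraicGeometry.CossartJannsenSaito2020.NearFibreNormalDirectrix
import HarnessLib

/-!
# [OURS · L1 W4.2] The STRATA-half of the MOVING W-ladder, seventh layer: the NEAR-FIBRE row (b-fib) CLOSED from
# CJS Thm. 3.14 for a positive-dimensional centre in the near-fibre rendering (named fact `Thm314_nearFibre_subsingleton`) — PROVED

Crux chain w42 (`SigmaMaxModifications`, stmt-ResolutionOfSingularities-18506; skeleton `w_ladder` v6 on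
`SigmaMaxModificationsCorridor3`, stmt-ResolutionOfSingularities-19249), row «stub-4 → `Moving.Wlow3CharStrataM p`», seat
res-L1-w42-stub-4 (gen 4); companion of p500484 / p503069 / p503885 / p504439 / p505314 / p506465 / p508074 / p508693 /
p510273 / p511345. OURS (cell res-hironaka, slot W4.2); NOT statements of H. Hironaka's manuscript [Hironaka2017] nor of
[CossartJannsenSaito2020]; AI-drafted, weaker than expert review. Every `theorem` is PROVED; CONDITIONAL on the printed CJS
Thm. 3.14 taken BY NAME in two renderings: the numerical shadow `(h314 : CossartJannsenSaito2020_thm_3_14)` (p499700, only in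
the final assembly, through p511345) and the near-fibre rendering `(h314f : Thm314_nearFibre_subsingleton)` (Literature
`…CossartJannsenSaito2020/NearFibreNormalDirectrix.lean`: the printed conclusion «`x' ∈ ℙ(Dir_x(X)/T_x(D))`» in the case
`dim_{k(x)}(Dir_x(X)/T_x(D)) ≤ 1`, where that projective space has at most one point). Helper file
`--supports stmt-ResolutionOfSingularities-19249`.

## What is proved

* §1 `one_le_ringKrullDim_quotient_stalkIdeal` — a non-trivial generisation `a ⤳ x` inside the support of an ideal sheaf
  `I` gives the two primes `𝔭_a < 𝔪_x ⊇ I_x` of `𝒪_{X,x}`, hence `1 ≤ dim (𝒪_{X,x}/I_x)` (sibling of p511345's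
  `two_le_ringKrullDim_quotient_stalkIdeal`).
* §2 `StepProjection.nearFibre_subsingleton` — the named fact read on a step projection `f : X_{n+1} ⟶ X_n` of the canonical
  sequence: if the canonical centre `C ∋ x_n` is permissible, `X_n` is excellent of dimension `≤ N`, `CharHypothesis X_n x_n`,
  `x_n ∈ X_n(ν)` and `e_{x_n}(X_n) ≤ dim 𝒪_{V(C),x_n} + 1`, then the points of `X_{n+1}(ν)` over `x_n` form a subsingleton
  (they are near to `x_n`).
* §3 `strataNearFibreSubsingleton_of_thm314_nearFibre : Thm314_nearFibre_subsingleton → ∀ p, StrataNearFibreSubsingleton p 3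
  (QNe (QCharRegime p)) (ē ≤ 2)` — **row (b-fib) of p510273 CLOSED in the (F1) regime**: at a blown-up CYCLE-END step the
  centre is the treated part `Y_n^{(j)} ∋ x_n` (p503069 `support_eq_part_of_next_none`), whose irreducible components are
  components of `X_n(ν)` (p510273 `componentsIn_part_subset`); the chain point is never isolated, so `{x_n}` is not one of them
  (p504439 `CycleInv.singleton_notMem_componentsIn_of_not_iso`) and the component of `Y_n^{(j)}` through `x_n` has a generic
  point `η ≠ x_n`, `η ⤳ x_n`: `1 ≤ dim 𝒪_{V(C),x_n}` (§1), so `e_{x_n} ≤ ē_{x_n} ≤ 2 ≤ dim 𝒪_{V(C),x_n} + 1` and §2 applies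
  (`CharHypothesis` from `QCharRegime`, stub-2's `charHypothesis_of_qCharRegime`; permissibility / excellence / `dim ≤ 3` from
  the good state, `stateGood_of_reaches`).
* §4 the strata-half with (b-fib) AND (b-curve) discharged:
  `wlow3CharStrataM_of_thm_3_14_nearFibre_centreIO_cycleStartRegular : CossartJannsenSaito2020_thm_3_14 →
  Thm314_nearFibre_subsingleton → (c-geo) → (c-reg) → Wlow3CharStrataM p` — the STRATA row now rests on the printed Thm. 3.14
  (two renderings) and the two geometric kernels (c-geo) `StrataLineageInCentreIO` (the dimension-two kernel; also card H's
  `strataLineageInCentreIO_of_localChains`) and (c-reg) `StrataCycleStartRegular`.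

References: CJS LNM 2270 Thm. 3.14 (p. 51), Def. 3.13 (1), Thm. 3.2 (2)(ii), Def. 3.1, Rem. 6.29 (1) [CossartJannsenSaito2020];
Stacks 01J7 [StacksProject]; tree p499700 (`NearPointDirectrix`), p503241 (`NearPointProjDirectrix`: the POINT-centre locus form
`Thm314_point_locus` and `ProjDir_line`, the latter PROVED p509891), this seat's files above.
-/

noncomputable section

-- plan-1/idea-2 module setting kept (namespace `…Corridor3.Moving` re-enters `…Corridor3`)
set_option linter.dupNamespace false

open CategoryTheory AlgebraicGeometry TopologicalSpace Topology IsLocalRing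
open Summit.ResolutionOfSingularities.ResolutionOfSingularities.Theorems.CampaignW42
open Literature.AlgebraicGeometry.Resolution Literature.RingTheory.HilbertSamuel
open Literature.AlgebraicGeometry.CossartJannsenSaito2020
open Summit.ResolutionOfSingularities.ResolutionOfSingularities.Theorems.SigmaMaxModificationsCorridor3

universe u

namespace Summit.ResolutionOfSingularities.ResolutionOfSingularities.Theorems.SigmaMaxModificationsCorridor3.Moving

variable {R : ∀ S : Scheme.{u}, CentreSeq S → Prop} {N : ℕ} {ν : ℕ → ℕ}

/-! ## §1. A non-trivial generisation in `V(I)` gives `dim 𝒪_{X,x}/I_x ≥ 1` -/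

/-- **A non-trivial generisation `a ⤳ x`, `a ≠ x`, inside the support of the ideal sheaf `I` forces `1 ≤ dim (𝒪_{X,x} / I_x)`**:
the primes `𝔭_a < 𝔪_x` of `𝒪_{X,x}` both contain `I_x`. [cite: StacksProject, Tag 01J7] -/
theorem one_le_ringKrullDim_quotient_stalkIdeal {X : Scheme.{u}} (I : X.IdealSheafData) {x a : X} (hax : a ⤳ x)
    (hne : a ≠ x) (haI : a ∈ I.support) :
    (1 : WithBot ℕ∞) ≤ ringKrullDim (X.presheaf.stalk x ⧸ stalkIdeal I x) := by
  rw [ringKrullDim_quotient]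
  haveI h₁p : (primeOfSpecializes hax).IsPrime := Ideal.IsPrime.comap _
  have h₁₀ : primeOfSpecializes hax ≤ maximalIdeal (X.presheaf.stalk x) := le_maximalIdeal h₁p.ne_top
  have hne₁₀ : primeOfSpecializes hax ≠ maximalIdeal (X.presheaf.stalk x) := fun h =>
    hne (hax.antisymm (specializes_of_primeOfSpecializes_le hax (specializes_refl x)
      (by rw [Literature.AlgebraicGeometry.Resolution.primeOfSpecializes_refl]; exact h.symm.le))).eq
  have hJ₁ : stalkIdeal I x ≤ primeOfSpecializes hax := (mem_support_iff_stalkIdeal_le_primeOfSpecializes hax I).mp haI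
  have hJ₀ : stalkIdeal I x ≤ maximalIdeal (X.presheaf.stalk x) := hJ₁.trans h₁₀
  let q₁ : ↥(PrimeSpectrum.zeroLocus (R := X.presheaf.stalk x) (stalkIdeal I x : Set (X.presheaf.stalk x))) :=
    ⟨⟨primeOfSpecializes hax, h₁p⟩, by
      rw [PrimeSpectrum.mem_zeroLocus, SetLike.coe_subset_coe]; exact hJ₁⟩
  let q₀ : ↥(PrimeSpectrum.zeroLocus (R := X.presheaf.stalk x) (stalkIdeal I x : Set (X.presheaf.stalk x))) :=
    ⟨⟨maximalIdeal _, (maximalIdeal.isMaximal _).isPrime⟩, by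
      rw [PrimeSpectrum.mem_zeroLocus, SetLike.coe_subset_coe]; exact hJ₀⟩
  have hlt₁₀ : q₁ < q₀ := lt_of_le_of_ne h₁₀ fun h => hne₁₀ (by
    have := congrArg (fun q : ↥(PrimeSpectrum.zeroLocus (R := X.presheaf.stalk x)
      (stalkIdeal I x : Set (X.presheaf.stalk x))) => q.1.asIdeal) h
    exact this)
  let l : LTSeries ↥(PrimeSpectrum.zeroLocus (R := X.presheaf.stalk x) (stalkIdeal I x : Set (X.presheaf.stalk x))) :=
    LTSeries.mk 1 ![q₁, q₀] (Fin.strictMono_iff_lt_succ.mpr fun i => by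
      fin_cases i
      simpa using hlt₁₀)
  have hl : l.length = 1 := rfl
  have := Order.le_krullDim_iff.mpr ⟨l, hl⟩
  exact_mod_cast this

/-! ## §2. The named fact read on a step projection of the canonical sequence -/

/-- **The points of `X_{n+1}(ν)` over `x_n` form a subsingleton** when the blow-down `f : X_{n+1} ⟶ X_n` of a canonical near
step has a permissible centre `C ∋ x_n` on an excellent stage of dimension `≤ N`, `CharHypothesis X_n x_n` holds, `x_n ∈ X_n(ν)`
and `e_{x_n}(X_n) ≤ dim 𝒪_{V(C),x_n} + 1`: they are near to `x_n`, and Thm. 3.14 (near-fibre rendering) applies.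
[cite: CossartJannsenSaito2020, Thm. 3.14, Def. 3.13 (1)] -/
theorem StepProjection.nearFibre_subsingleton (h314f : Thm314_nearFibre_subsingleton.{u}) (hRf : OracleFunctional R)
    {s s' : MarkedStage.{u}} {f : s'.W ⟶ s.W} (hf : StepProjection R N ν s s' f) {C : s.W.IdealSheafData}
    {P' : Option (Pending (blowup C))} (hcs : IsCanonicalStep R N ν s.L s.P C P') (hexc : Scheme.IsExcellent s.W)
    (hperm : IdealSheafData.IsPermissible C) (hdim : topologicalKrullDim s.W ≤ (N : WithBot ℕ∞))
    (hmem : s.pt ∈ (C.support : Set s.W)) (hchar : CharHypothesis s.W s.pt) (hpt : s.pt ∈ Scheme.hsStratum s.W N ν)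
    (he : (@Scheme.dirDim s.W s.ln s.pt : WithBot ℕ∞) ≤ ringKrullDim (s.W.presheaf.stalk s.pt ⧸ stalkIdeal C s.pt) + 1) :
    {z : s'.W | f.base z = s.pt ∧ z ∈ Scheme.hsStratum s'.W N ν}.Subsingleton := by
  haveI := s.ln
  obtain ⟨C₂, P₂, hln, x', hcs₂, hπ, hcl, hx', e, rfl⟩ := hf
  obtain rfl : C₂ = C := hcs₂.centre_unique hRf hcs
  subst e
  simp only [eqToHom_refl, Category.id_comp]
  have key := h314f s.W (blowup C₂) (blowup.π C₂) C₂ hexc hperm (blowup.isBlowup C₂) N hdim s.pt hmem hchar he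
  refine key.anti fun z hz => ⟨hz.1, ?_⟩
  rw [Scheme.mem_hsStratum_iff.mp hz.2, Scheme.mem_hsStratum_iff.mp hpt]

/-! ## §3. Row (b-fib) from the named fact in the (F1) regime -/

/-- **ROW (b-fib) CLOSED (conditional on the printed Thm. 3.14 in the near-fibre rendering, by name): in the (F1) regime
`QCharRegime p`, with `ν ≠ Φ^{(3)}` (`QNe`), along every never-isolated chain from a maximal origin of characteristic `p` with
`ē ≤ 2`, at EVERY blown-up cycle-end step the points of `X_{n+1}(ν)` over `x_n` form a subsingleton.** The centre is the treated
part `Y_n^{(j)} ∋ x_n`; its component through the never-isolated chain point is positive-dimensional, so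
`e_{x_n} ≤ ē_{x_n} ≤ 2 ≤ dim 𝒪_{Y,x_n} + 1`. [cite: CossartJannsenSaito2020, Thm. 3.14, Rem. 6.29 (1)] -/
theorem strataNearFibreSubsingleton_of_thm314_nearFibre (h314f : Thm314_nearFibre_subsingleton.{u}) (p : ℕ) :
    StrataNearFibreSubsingleton.{u} p 3 (QNe (Helpers.QCharRegime p)) fun s => s.geomDirDim ≤ 2 := by
  intro R hRf hRa ν X _ x hX hQ c h0 hstep hG hnI _
  refine ⟨0, fun n _ hbu hnone f hf => ?_⟩
  obtain ⟨hq, hν⟩ := hQ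
  -- the good state at stage `n` for the ground field of the origin, and (F1) at the chain point
  obtain ⟨k, _, _, g, -, hft, hqc⟩ := hX.exists_structure
  haveI := hft
  haveI := hqc
  haveI := hX.isReduced
  have hgood : StateGood k R 3 ν (c n).W (c n).L (c n).P :=
    stateGood_of_reaches (stateGood_init_general hRa g hX.dim_le hX.maximal hν) (reaches_chain h0 hstep n)
  have hchar : CharHypothesis (c n).W (c n).pt := charHypothesis_of_qCharRegime hX hq (reaches_chain h0 hstep n) hgood
  -- the cycle package along the chain: closed strata, never-isolated chain points are not components
  obtain ⟨-, k', _, hinv⟩ := exists_cycleInv_chain' hRf hRa hX h0 hstep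
  haveI : IsLocallyNoetherian (c n).W := (c n).ln
  haveI : IsNoetherian (c n).W := (hinv n).isNoetherian
  have hpt : (c n).pt ∈ Scheme.hsStratum (c n).W 3 ν := pt_mem_hsStratum_of_reaches hX.mem_stratum (reaches_chain h0 hstep n)
  have hptcl : IsClosed ({(c n).pt} : Set (c n).W) := Reaches.isClosed_pt hX.isClosed (reaches_chain h0 hstep n)
  -- the chain point lies in the centre = the treated part
  obtain ⟨C, P₁, hcs, hmem⟩ := hbu
  have hsupp : (C.support : Set (c n).W) = (c n).L.part (Scheme.hsStratum (c n).W 3 ν) (treatedLabel 3 ν (c n)) :=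
    support_eq_part_of_next_none hRf (hstep n) hnone hcs
  -- the component of the treated part through `x_n` is not `{x_n}`: a generic point `η ≠ x_n` specialising to `x_n`
  obtain ⟨D₀, hD₀, hxD₀⟩ := componentsIn.exists_mem hmem
  have hD₀' : D₀ ∈ componentsIn (Scheme.hsStratum (c n).W 3 ν) := by
    have hD₀p : D₀ ∈ componentsIn ((c n).L.part (Scheme.hsStratum (c n).W 3 ν) (treatedLabel 3 ν (c n))) := hsupp ▸ hD₀
    exact componentsIn_part_subset (c n).L (hinv n).isClosed_hsStratum (componentsIn.finite _) _ hD₀p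
  have hD₀ne : D₀ ≠ {(c n).pt} := fun h =>
    (hinv n).singleton_notMem_componentsIn_of_not_iso hpt (hnI n) (h ▸ hD₀')
  have hD₀irr : IsIrreducible D₀ := componentsIn.isIrreducible hD₀
  have hD₀cl : IsClosed D₀ := componentsIn.isClosed C.support.isClosed hD₀
  have hDgen : IsGenericPoint hD₀irr.genericPoint D₀ := hD₀irr.isGenericPoint_genericPoint hD₀cl
  set η := hD₀irr.genericPoint with hηdef
  have hηx : η ⤳ (c n).pt := hDgen.specializes hxD₀
  have hηne : η ≠ (c n).pt := by
    intro h
    apply hD₀ne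
    rw [← hDgen.def, h, hptcl.closure_eq]
  have hηI : η ∈ C.support := (componentsIn.subset hD₀) hDgen.mem
  have h1 : (1 : WithBot ℕ∞) ≤ ringKrullDim ((c n).W.presheaf.stalk (c n).pt ⧸ stalkIdeal C (c n).pt) :=
    one_le_ringKrullDim_quotient_stalkIdeal C hηx hηne hηI
  -- `e_{x_n} ≤ ē_{x_n} ≤ 2 ≤ dim 𝒪_{V(C),x_n} + 1`
  have he2 : (Scheme.dirDim (c n).W (c n).pt : WithBot ℕ∞) ≤ 2 := by
    have h1 : Scheme.dirDim (c n).W (c n).pt ≤ 2 := (Scheme.dirDim_le_geomDirDim (c n).pt).trans (hG n)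
    exact_mod_cast h1
  have he : (Scheme.dirDim (c n).W (c n).pt : WithBot ℕ∞) ≤
      ringKrullDim ((c n).W.presheaf.stalk (c n).pt ⧸ stalkIdeal C (c n).pt) + 1 := by
    refine he2.trans ?_
    have h2 : (2 : WithBot ℕ∞) = 1 + 1 := by norm_num
    rw [h2]
    exact add_le_add h1 le_rfl
  exact hf.nearFibre_subsingleton h314f hRf hcs hgood.isExcellent (hgood.isPermissible hcs) hgood.dim_le hmem hchar hpt he

/-! ## §4. The strata-half with (b-fib) and (b-curve) discharged -/

/-- **`Wlow3CharStrataM p` (G1′) FROM THE PRINTED Thm. 3.14 (numerical shadow and near-fibre rendering, by name), (c-geo) AND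
(c-reg).** [cite: CossartJannsenSaito2020, Thm. 3.14, Thm. 6.35, Rem. 6.29 (1)] -/
theorem wlow3CharStrataM_of_thm_3_14_nearFibre_centreIO_cycleStartRegular {p : ℕ} (h314 : CossartJannsenSaito2020_thm_3_14.{0})
    (h314f : Thm314_nearFibre_subsingleton.{0})
    (hgeo : StrataLineageInCentreIO.{0} p 3 (QNe (Helpers.QCharRegime p)) fun s => s.geomDirDim ≤ 2)
    (hreg : StrataCycleStartRegular.{0} p 3 (QNe (Helpers.QCharRegime p)) fun s => s.geomDirDim ≤ 2) :
    Wlow3CharStrataM p :=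
  wlow3CharStrataM_of_thm_3_14_fibre_centreIO_cycleStartRegular h314
    (strataNearFibreSubsingleton_of_thm314_nearFibre h314f p) hgeo hreg

/-- … and the units/strata JOIN of the registered row: `Wlow3CharM p` from the F-key, the two units-half sockets, Thm. 3.14 (two
renderings), (c-geo), (c-reg). [cite: CossartJannsenSaito2020, Thm. 6.40, Cor. 6.37, Thm. 6.35, Thm. 3.14] -/
theorem wlow3CharM_of_extraction_thm_3_14_nearFibre_centreIO_cycleStartRegular {p : ℕ} (hK : KeyTheorem640_char_isolated.{0})
    (hlow : IsoLowDirDimTerminatesM p) (hext : UnitTowerExtractionQM p) (h314 : CossartJannsenSaito2020_thm_3_14.{0})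
    (h314f : Thm314_nearFibre_subsingleton.{0})
    (hgeo : StrataLineageInCentreIO.{0} p 3 (QNe (Helpers.QCharRegime p)) fun s => s.geomDirDim ≤ 2)
    (hreg : StrataCycleStartRegular.{0} p 3 (QNe (Helpers.QCharRegime p)) fun s => s.geomDirDim ≤ 2) : Wlow3CharM.{0} p :=
  wlow3CharM_assembled hK hlow hext (wlow3CharStrataM_of_thm_3_14_nearFibre_centreIO_cycleStartRegular h314 h314f hgeo hreg)

/-- The exactness of p510273 with (b-fib) and (b-curve) discharged: in the (F1) regime the strata row is EQUIVALENT to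
(c-geo) ∧ (c-reg), given the two renderings of Thm. 3.14. [cite: CossartJannsenSaito2020, Thm. 3.14, Rem. 6.29 (1)] -/
theorem wlow3CharStrataM_iff_centreIO_cycleStartRegular_of_thm_3_14 {p : ℕ} (h314 : CossartJannsenSaito2020_thm_3_14.{0})
    (h314f : Thm314_nearFibre_subsingleton.{0}) :
    Wlow3CharStrataM p ↔
      (StrataLineageInCentreIO.{0} p 3 (QNe (Helpers.QCharRegime p)) fun s => s.geomDirDim ≤ 2) ∧
        StrataCycleStartRegular.{0} p 3 (QNe (Helpers.QCharRegime p)) fun s => s.geomDirDim ≤ 2 := by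
  refine ⟨fun h => ?_, fun ⟨hgeo, hreg⟩ => wlow3CharStrataM_of_thm_3_14_nearFibre_centreIO_cycleStartRegular h314 h314f hgeo hreg⟩
  have h' := (maxOriginNoMovingNearChainAtQ_notIso_iff_fibre_curve_centreIO_cycleStartRegular
    (p := p) (N := 3) (Q := Helpers.QCharRegime p) (G := fun s => s.geomDirDim ≤ 2)).mp h
  exact ⟨h'.2.2.1, h'.2.2.2⟩

end Summit.ResolutionOfSingularities.ResolutionOfSingularities.Theorems.SigmaMaxModificationsCorridor3.Moving

end
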